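import Summits.BirchSwinnertonDyer.Rank1Residual.X11b.Three.ImageAtThree
import Summits.BirchSwinnertonDyer.Rank1Residual.X11b.Three.StepLAtThree
import Literature.NumberTheory.EllipticCurves.SerreOpenImageDeterminantProofs
import Literature.NumberTheory.GaloisRepresentations.ImaginaryQuadraticCyclotomicProofs
import Literature.NumberTheory.Automorphic.QuadraticCharacterTwist
import HarnessLib

/-!
# X11b at `p = 3` (team N8/O2), sub-target S6 · IMG3a, part (b): the field corollary —
# `ρ̄_{E,3}|_{G_K}` is still onto `Aut(E[3])` for every quadratic `K` with `3 ∤ d_K`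
# (in particular for every Heegner field at a multiplicative `3`), and `ℚ(√−3)` is the unique
# quadratic subfield of `ℚ(E[3])`

HONEST FRAMING (cell `b2b-bsdres`, run/shared/lean/b2b/bsd-rank1-residual/, verbatim in every
file): the goal of the cell is to DELETE the COMBINATION-SHAPED residual classes of the
Birch–Swinnerton-Dyer formula for ALL analytic-rank `≤ 1` elliptic curves over `ℚ` — "full BSD
formula for every rank `≤ 1` curve in class `C`" assembled STRICTLY from published theorems — so
that the rank-`≤ 1` remainder becomes exactly the CONSTRUCTION-SHAPED classes, which are TYPED
(missing-input `Prop`s), NOT attempted. This is not "finishing BSD". Team N8/O2 = `x11b3` (X11b at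
`p = 3`), seat `b2b-bsdres-x11b3-p1`, sub-target S6 of `cells/x11b3/PLAN.md`, part (b) (the field
corollary of part (a) = `ImageAtThree.lean`). THEOREMS ONLY (no definition, no named fact, no
`sorry`); nothing is booked; no label changes; O2 unchanged.

## What this file proves, and where it is used

PLAN §2 S6: "under `Surj W 3` the unique quadratic subfield of `ℚ(E[3])` is `ℚ(√−3)`, hence
`K ≠ ℚ(√−3) ⇒ K ∩ ℚ(E[3]) = ℚ` and `ρ̄|_{G_K}` stays surjective (the `p = 3` form of SZ14 (β)/(γ),
Howard 2004 'Gal(K̄/K) → Aut(T) surjective' at layer 1, BCK 'abs. irr. on `G_K`')". In the tree's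
`Γ_ℚ`-vocabulary (`Field.absoluteGaloisGroup`, `WeierstrassCurve.galoisRepTorsion W 3 : Γ_ℚ →*
Aut(E[3])`, `absGaloisRestrict ℚ K : Γ_K → Γ_ℚ` with range `Gal(ℚ̄/e(K))` of index `2` for a
quadratic `K`, the mod-`3` cyclotomic character `modPCyclotomicCharacterZMod ℚ 3 = χ₃`):

* `map_galoisRepTorsion_eq_top_of_index_two` — for `ρ̄_{E,3}` onto and ANY `Γ' ≤ Γ_ℚ` of index
  `2` other than `ker χ₃ = Gal(ℚ̄/ℚ(√−3))`: `ρ̄_{E,3}(Γ') = Aut(E[3])`. Inputs: part (a)'s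
  `GL2F3.map_eq_top_or_eq_ker_of_index_two` and the tree THEOREM `det ∘ Φ ∘ ρ̄_{E,3} = χ₃` for a
  frame `Φ : Aut(E[3]) ≅ GL₂(𝔽₃)` (`WeierstrassCurve.exists_frame_galoisRepTorsion_rat`: the Weil
  pairing, Silverman *AEC* III.8.1, proved in the tree).
* `eq_ker_cyclotomic_of_index_two_of_ker_le` — **the unique quadratic subfield of `ℚ(E[3])` is
  `ℚ(ζ₃)`**: an index-`2` subgroup of `Γ_ℚ` containing `ker ρ̄_{E,3}` is `ker χ₃`.
* `discr_eq_neg_three_of_range_le_ker_cyclotomic` — if `Gal(ℚ̄/e(K)) ≤ ker χ₃` for a quadratic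
  number field `K`, then `d_K = −3` (a primitive cube root of unity of `ℚ̄` is then fixed by
  `Gal(ℚ̄/e(K))`, so lies in `e(K)` by the infinite Galois correspondence —
  `Rat.exists_eq_of_forall_range_absGaloisRestrict_smul` — and a cube root of unity in a quadratic
  field forces `d_K = −3`, `StepLAtThree`'s `discr_eq_neg_three_of_sq_add_self_add_one`).
* **`surjective_galoisRepTorsion_comp_absGaloisRestrict_of_not_dvd_discr`** — for `E/ℚ` with
  `ρ̄_{E,3}` onto and `K` a quadratic number field with `3 ∤ d_K`: `ρ̄_{E,3} ∘ (Γ_K → Γ_ℚ)` is onto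
  `Aut(E[3])`; and its Heegner / X11b-at-3 forms `…_of_heegner` (`K` imaginary quadratic with the
  Heegner hypothesis for `N`, `3 ∣ N`) and `…_of_classX11b` (`(E,3) ∈` X11b, `K` Heegner for `N_E`)
  — exactly the binders of the open input `X11b.Three.StepLAt`.

References: J.-P. Serre, Invent. Math. 15 (1972) §1.11, §5.2; C. Skinner, W. Zhang,
arXiv:1407.1099 (the role of (β)/(γ)); B. Howard, Compositio 140 (2004) §1.1 (image hypothesis);
team file `cells/x11b3/PLAN.md` §2 S6.
-/

noncomputable section

open scoped Classical

open WeierstrassCurve Field Module NumberField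
  Literature.NumberTheory.EllipticCurves Literature.NumberTheory.EllipticCurves.Rank1Residual
  Literature.NumberTheory.GaloisRepresentations Literature.NumberTheory.Automorphic

namespace Summit.BirchSwinnertonDyer.Rank1Residual.X11b.Three

/-! ### `Γ_ℚ`-level statements -/

section Rational

variable (W : WeierstrassCurve ℚ) [W.IsElliptic]

omit [W.IsElliptic] in
/-- `ker(det ∘ Φ ∘ ρ̄_{E,3}) = ker χ₃` for any frame `Φ` with `det ∘ Φ ∘ ρ̄ = χ₃`. [folklore] -/
theorem ker_det_comp_frame_eq_ker_cyclotomic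
    (Φ : Multiplicative (AddAut (geomTorsion W (3 : ℕ))) ≃* GL (Fin 2) (ZMod 3))
    (hdet : ∀ σ : absoluteGaloisGroup ℚ,
      Matrix.GeneralLinearGroup.det (Φ (galoisRepTorsion W (3 : ℕ) σ)) =
        modPCyclotomicCharacterZMod ℚ 3 σ) :
    (((Matrix.GeneralLinearGroup.det : GL (Fin 2) (ZMod 3) →* (ZMod 3)ˣ).comp
        Φ.toMonoidHom).comp (galoisRepTorsion W (3 : ℕ))).ker =
      (modPCyclotomicCharacterZMod ℚ 3).ker := by
  ext σ
  rw [MonoidHom.mem_ker, MonoidHom.mem_ker, MonoidHom.comp_apply, MonoidHom.comp_apply,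
    MulEquiv.coe_toMonoidHom, hdet]

/-- **For `ρ̄_{E,3}` onto, every index-`2` subgroup `Γ' ≠ ker χ₃` of `Γ_ℚ` still maps ONTO
`Aut(E[3])`.** (`GL2F3.map_eq_top_or_eq_ker_of_index_two` + the Weil pairing
`det ∘ ρ̄_{E,3} = χ₃`, tree theorem `exists_frame_galoisRepTorsion_rat`.) [folklore] -/
theorem map_galoisRepTorsion_eq_top_of_index_two (hsurj : W.HasSurjectiveModNGaloisRep (3 : ℕ))
    (Γ' : Subgroup (absoluteGaloisGroup ℚ)) (hΓ' : Γ'.index = 2)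
    (hne : Γ' ≠ (modPCyclotomicCharacterZMod ℚ 3).ker) :
    Γ'.map (galoisRepTorsion W (3 : ℕ)) = ⊤ := by
  obtain ⟨_, Φ, -, -, hdet, -, -⟩ := exists_frame_galoisRepTorsion_rat W 3
  rcases GL2F3.map_eq_top_or_eq_ker_of_index_two Φ (galoisRepTorsion W (3 : ℕ)) hsurj Γ' hΓ' with
    h | h
  · exact h
  · exact absurd (h.trans (ker_det_comp_frame_eq_ker_cyclotomic W Φ hdet)) hne

/-- **The unique quadratic subfield of `ℚ(E[3])` is `ℚ(ζ₃)`** (for `ρ̄_{E,3}` onto): an index-`2`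
subgroup of `Γ_ℚ` containing `ker ρ̄_{E,3} = Gal(ℚ̄/ℚ(E[3]))` equals `ker χ₃ = Gal(ℚ̄/ℚ(ζ₃))`.
(Its image has index `2` in `Aut(E[3]) ≅ GL₂(𝔽₃)`, so is `ker(det ∘ Φ)` by part (a); pull back.)
[folklore] -/
theorem eq_ker_cyclotomic_of_index_two_of_ker_le (hsurj : W.HasSurjectiveModNGaloisRep (3 : ℕ))
    (Γ' : Subgroup (absoluteGaloisGroup ℚ)) (hΓ' : Γ'.index = 2)
    (hker : (galoisRepTorsion W (3 : ℕ)).ker ≤ Γ') :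
    Γ' = (modPCyclotomicCharacterZMod ℚ 3).ker := by
  obtain ⟨_, Φ, -, -, hdet, -, -⟩ := exists_frame_galoisRepTorsion_rat W 3
  set ρ := galoisRepTorsion W (3 : ℕ) with hρ
  have hidx : (Γ'.map ρ).index = 2 := by rw [Subgroup.index_map_eq Γ' (f := ρ) hsurj hker, hΓ']
  have himg := GL2F3.eq_ker_of_index_two_of_mulEquiv Φ (Γ'.map ρ) hidx
  -- pull back along `ρ`: `Γ' = ρ⁻¹(ρ(Γ'))` since `ker ρ ≤ Γ'`
  have hpull : Γ' = (Γ'.map ρ).comap ρ := (Subgroup.comap_map_eq_self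
    (by simpa [hρ] using hker)).symm
  rw [hpull, himg, MonoidHom.comap_ker, ker_det_comp_frame_eq_ker_cyclotomic W Φ hdet]

/-- `[Γ_ℚ : ker χ₃] = 2` (`χ₃` is onto `𝔽₃^×`, of order `2`). [folklore] -/
theorem index_ker_modPCyclotomicCharacterZMod_three :
    (modPCyclotomicCharacterZMod ℚ 3).ker.index = 2 := by
  haveI : NeZero ((3 : ℕ) : ℚ) := ⟨by norm_num⟩
  rw [Subgroup.index_ker, MonoidHom.range_eq_top.mpr
    (modPCyclotomicCharacterZMod_rat_surjective 3), Subgroup.card_top, Nat.card_eq_fintype_card,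
    ZMod.card_units_eq_totient]
  decide

end Rational

/-! ### Quadratic fields: `Gal(ℚ̄/K) ≤ ker χ₃` forces `d_K = −3` -/

section Quadratic

variable (K : Type) [Field K] [NumberField K]

/-- **If `Gal(ℚ̄/e(K))` acts trivially on `μ₃` then `d_K = −3`** (`K` a quadratic number field):
a primitive cube root of unity `ζ ∈ ℚ̄` is fixed by `Gal(ℚ̄/e(K))`, hence `ζ = e(x)` for some
`x ∈ K` (infinite Galois correspondence, `Rat.exists_eq_of_forall_range_absGaloisRestrict_smul`),
`x² + x + 1 = 0`, `x ∈ 𝓞 K`, and `discr_eq_neg_three_of_sq_add_self_add_one`. [folklore] -/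
theorem discr_eq_neg_three_of_range_le_ker_cyclotomic (h2 : finrank ℚ K = 2)
    (hle : ((absGaloisRestrict ℚ K).range : Subgroup (absoluteGaloisGroup ℚ)) ≤
      (modPCyclotomicCharacterZMod ℚ 3).ker) :
    NumberField.discr K = -3 := by
  haveI : NeZero ((3 : ℕ) : ℚ) := ⟨by norm_num⟩
  haveI : Fact (1 < 3) := ⟨by norm_num⟩
  -- a primitive cube root of unity `ζ ∈ ℚ̄`: `ζ³ = 1`, `ζ² + ζ + 1 = 0`
  obtain ⟨ζ, hζp⟩ := HasEnoughRootsOfUnity.exists_primitiveRoot (AlgebraicClosure ℚ) 3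
  have hζ3 : ζ ^ 3 = 1 := hζp.pow_eq_one
  have hζ : ζ ^ 2 + ζ + 1 = 0 := by
    have h := hζp.geom_sum_eq_zero (by norm_num : 1 < 3)
    rw [Finset.sum_range_succ, Finset.sum_range_succ, Finset.sum_range_succ,
      Finset.sum_range_zero] at h
    linear_combination h
  -- `ζ` is fixed by `Gal(ℚ̄/e(K))`
  have hfix : ∀ τ ∈ ((absGaloisRestrict ℚ K).range : Subgroup (absoluteGaloisGroup ℚ)),
      τ • ζ = ζ := by
    intro τ hτ
    have h1 : modPCyclotomicCharacterZMod ℚ 3 τ = 1 := hle hτ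
    rw [modPCyclotomicCharacterZMod_spec ℚ 3 τ ζ hζ3, h1, Units.val_one, ZMod.val_one, pow_one]
  obtain ⟨e, x, hx⟩ := Rat.exists_eq_of_forall_range_absGaloisRestrict_smul K hfix
  -- `x² + x + 1 = 0` in `K`
  have hxK : x ^ 2 + x + 1 = 0 := by
    apply e.toRingHom.injective
    rw [map_zero, map_add, map_add, map_pow, map_one]
    change e x ^ 2 + e x + 1 = 0
    rw [hx, hζ]
  -- `x ∈ 𝓞 K`
  have hx3 : x ^ 3 = 1 := by linear_combination (x - 1) * hxK
  have hint : IsIntegral ℤ x := IsIntegral.of_pow (by norm_num : 0 < 3) (by rw [hx3]; exact isIntegral_one)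
  set y : 𝓞 K := ⟨x, hint⟩ with hy
  have hyK : y ^ 2 + y + 1 = 0 := by
    apply RingOfIntegers.ext
    change algebraMap (𝓞 K) K (y ^ 2 + y + 1) = algebraMap (𝓞 K) K 0
    rw [map_add, map_add, map_pow, map_one, map_zero, hy, RingOfIntegers.map_mk]
    exact hxK
  exact discr_eq_neg_three_of_sq_add_self_add_one h2 hyK

/-- Hence for a quadratic number field with `3 ∤ d_K`, `Gal(ℚ̄/e(K)) ≠ ker χ₃`. [folklore] -/
theorem range_absGaloisRestrict_ne_ker_cyclotomic (h2 : finrank ℚ K = 2)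
    (h3 : ¬ (3 : ℤ) ∣ NumberField.discr K) :
    ((absGaloisRestrict ℚ K).range : Subgroup (absoluteGaloisGroup ℚ)) ≠
      (modPCyclotomicCharacterZMod ℚ 3).ker := by
  intro h
  exact h3 ⟨-1, by rw [discr_eq_neg_three_of_range_le_ker_cyclotomic K h2 h.le]; norm_num⟩

end Quadratic

/-! ### The corollary: `ρ̄_{E,3}|_{G_K}` is onto -/

section Corollary

variable (W : WeierstrassCurve ℚ) [W.IsElliptic] (K : Type) [Field K] [NumberField K]

/-- **`ρ̄_{E,3}|_{G_K}` is onto `Aut(E[3])` for every quadratic number field `K` with `3 ∤ d_K`**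
(given `ρ̄_{E,3} : Γ_ℚ → Aut(E[3])` onto): the `p = 3` form of the image arguments (β)/(γ) — no
"`p ∤ #GL₂(𝔽_p)`" is used, only part (a)'s structure of `GL₂(𝔽₃)` and the Weil pairing.
[folklore] -/
theorem surjective_galoisRepTorsion_comp_absGaloisRestrict_of_not_dvd_discr
    (hsurj : W.HasSurjectiveModNGaloisRep (3 : ℕ)) (h2 : finrank ℚ K = 2)
    (h3 : ¬ (3 : ℤ) ∣ NumberField.discr K) :
    Function.Surjective ((galoisRepTorsion W (3 : ℕ)).comp
      (absGaloisRestrict ℚ K : absoluteGaloisGroup K →* absoluteGaloisGroup ℚ)) := by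
  have hidx := (isOpen_range_absGaloisRestrict_and_index_eq_two ℚ K h2).2
  have htop := map_galoisRepTorsion_eq_top_of_index_two W hsurj _ hidx
    (range_absGaloisRestrict_ne_ker_cyclotomic K h2 h3)
  rw [← MonoidHom.range_eq_top, ← MonoidHom.map_range]
  exact htop

/-- **Heegner form**: for `K` imaginary quadratic satisfying the Heegner hypothesis for `N` with
`3 ∣ N` (so `3` splits in `K` and `3 ∤ d_K`, `StepLAtThree` §1) and `ρ̄_{E,3}` onto:
`ρ̄_{E,3}|_{G_K}` is onto. [folklore] -/
theorem surjective_galoisRepTorsion_comp_absGaloisRestrict_of_heegner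
    (hsurj : W.HasSurjectiveModNGaloisRep (3 : ℕ)) (hK : IsImaginaryQuadratic K) {N : ℕ}
    (hH : SatisfiesHeegnerHypothesis N K) (h3N : 3 ∣ N) :
    Function.Surjective ((galoisRepTorsion W (3 : ℕ)).comp
      (absGaloisRestrict ℚ K : absoluteGaloisGroup K →* absoluteGaloisGroup ℚ)) :=
  haveI : Fact (Nat.Prime 3) := ⟨Nat.prime_three⟩
  surjective_galoisRepTorsion_comp_absGaloisRestrict_of_not_dvd_discr W K hsurj hK.1
    (not_dvd_discr_and_not_dvd_torsionOrder_of_heegner hK hH (p := 3) (by decide) h3N).1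

/-- **X11b-at-3 form** (the binders of `X11b.Three.StepLAt`): for `W/ℚ` globally minimal with
`(E,3) ∈` X11b and `ρ̄_{E,3}` onto, and `K` imaginary quadratic with the Heegner hypothesis for
`N_E`: `ρ̄_{E,3}|_{G_K}` is onto `Aut(E[3])`. [folklore] -/
theorem surjective_galoisRepTorsion_comp_absGaloisRestrict_of_classX11b [W.IsGloballyMinimal]
    [Fact (Nat.Prime 3)] (hX : ClassX11b W 3) (hsurj : Surj W 3) (hK : IsImaginaryQuadratic K)
    {N : ℕ} (hN : W.conductorNorm ℤ = N) (hH : SatisfiesHeegnerHypothesis N K) :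
    Function.Surjective ((galoisRepTorsion W (3 : ℕ)).comp
      (absGaloisRestrict ℚ K : absoluteGaloisGroup K →* absoluteGaloisGroup ℚ)) :=
  surjective_galoisRepTorsion_comp_absGaloisRestrict_of_heegner W K hsurj hK hH
    (hN ▸ dvd_conductorNorm_of_classX11b hX)

end Corollary

end Summit.BirchSwinnertonDyer.Rank1Residual.X11b.Three

end
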